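import Summits.BirchSwinnertonDyer.BirchSwinnertonDyer.Theorems.PrintCf2RamifiedOffTYZLevelTwoModTwo
import HarnessLib

/-!
# Route `PrintCf2`, crux stmt-BirchSwinnertonDyer-20509 `RamifiedOffTYZOfFacts` — C⁺ AT DEPTH ONE THROUGH PROP. 3.4:
# `[P(n)] = [Σ_main + Σ_I] = [Z(n)]` in `A(ℍ′_n)/(2A(ℍ′_n) + A(ℍ′_n)_tor)` when the genus weights are even
# (cell `bsd-print-cf2`, LEAD of 20509 g2, line `offtyz-v7`, lineage cycle 3; sequel of `…LevelTwoModTwo`; fact-free, Theses-free, no `def`)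

HONEST FRAMING (cell `bsd-print-cf2`; route `PrintCf2`; crux 20509 = `𝔅_ram → WAllCornerFTwoRamifiedOffTYZProved`, DECIDING,
OPEN AS A CLASS): bookkeeping on PRINTED statements taken as hypotheses on the displayed data
`TianYuanZhang2017.GenusPointData` (`D.prop34`, `D.thm35Main`, `D.scriptLSpec`) — nothing asserted, no named fact.  The file
`PrintCf2RamifiedOffTYZLevelTwoModTwo` (§1–§2) shows: on the part `{ρ(n) = 0, [α_n] ≠ 0}` of the jump-one rank-one class,
the conclusion of C⁺ = `stub_offTYZ_levelTwoScriptLExact` at `n` is EQUIVALENT to `[P(n)] ≠ 0` in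
`V = A(ℍ′_n)/(2A(ℍ′_n) + A(ℍ′_n)_tor)`.  THIS FILE pushes that class through the displayed Proposition 3.4
(`P(n) ≡ Σ_main + Σ_I (mod 2A(ℍ′_n))`):

* `genusPoint_twoDivisible_iff_prop34Sums`: `[P(n)] = [Σ_main + Σ_I]`;
* `prop34SumMain_singleton_term` / `prop34SumI_singleton_term`: the `ℓ = 0` decomposition `{n}` contributes exactly `Z(n)`
  to the first sum and nothing to the second (the F-Σ2 term, "the contribution by `d₀ = n, d₁ = 1` is the single term
  `Z(n)`", proof of Prop. 3.4);
* `exists_prop34Sums_eq_Z_add_two_smul`: if every qualifying block (`MainBlock`/`IBlock`) of every NON-trivial decomposition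
  carries an EVEN weight `∏_{d ∈ S∖{d₀}} g(d)` — e.g. the whole `k = 2` sector of the jump-one class, where the only such
  weight is `g` of the prime `≡ 1 (mod 8)`, even by Rédei–Reichardt — then `Σ_main + Σ_I = Z(n) + 2·Q`;
* `levelTwo_iff_genusPeriod_not_twoDivisible`: on `{ρ = 0, [α_n] ≠ 0, even weights}` **C⁺ at `n` ⟺ the genus period `Z(n)`
  is NOT 2-divisible in `A(ℍ′_n)` modulo torsion** (granted GZK and the three displays).

LEAD census (crux 20509): this is the exact shape in which a depth-one genus theorem would discharge C⁺ on the visible part of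
the class.  The displayed Galois translates do not decide it: Thm 3.6 / Lemma 3.21 move `Z(n)` by `g(n)`-multiples of
`2`-torsion points, and `g(n)` is even throughout the class (the genus sums are even there, census 2417/2417), so `[Z(n)]` is
invisible to every torsion-valued cocycle in print.  Beyond-print theorem: NO (bookkeeping of printed statements); C⁺ stays
open.  BSD is not proved by any of this; no class is closed by this file.

References: [cite: TianYuanZhang2017, Prop. 3.4 and its proof (arXiv:1411.4728 chunk p0011 L76–L89, p0016 L146), Thm. 3.5
(p0011 L94–L112), Thm. 3.6 (p0012 L22–L40), Lemma 3.21 (p0020 L27–L45)]; [cite: Darmon2004, Thm. 3.22] (GZK);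
tree: `TianYuanZhang2017/GenusPointDescentDisplays.lean`, `Theorems/PrintCf2RamifiedOffTYZLevelTwoModTwo.lean`.
-/

noncomputable section

open scoped Classical

open WeierstrassCurve WeierstrassCurve.Affine Literature.NumberTheory.EllipticCurves
  Literature.NumberTheory.EllipticCurves.Rank1Residual Summit.BirchSwinnertonDyer.Rank1Residual
  Literature.NumberTheory.EllipticCurves.TianYuanZhang2017
  Literature.NumberTheory.EllipticCurves.TianYuanZhang2017.W2

set_option autoImplicit false

namespace Summit.BirchSwinnertonDyer.PrintCf2.LevelTwoModTwo

/-! ## §3 Through Prop. 3.4: `P(n)` ≡ the genus sums (mod `2A(ℍ′_n)`), and ≡ the genus period `Z(n)` when the weights are even -/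

section PropThreeFour

variable {n : ℕ}

/-- **Prop. 3.4 transports the depth-one class.** With the displayed Prop. 3.4 (`D.prop34`:
`P(n) − Σ_main − Σ_I ∈ 2A(ℍ′_n)`), `P(n)` is 2-divisible in `A(ℍ′_n)` modulo torsion iff the sum of the two displayed
genus-point sums is. [cite: TianYuanZhang2017, Prop. 3.4 (arXiv:1411.4728 chunk p0011 L76–L89)] -/
theorem genusPoint_twoDivisible_iff_prop34Sums (D : GenusPointData n) (h34 : D.prop34) :
    (∃ y : APoint D.H, IsOfFinAddOrder (D.P n - (2 : ℤ) • y)) ↔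
      ∃ y : APoint D.H, IsOfFinAddOrder ((D.prop34SumMain + D.prop34SumI) - (2 : ℤ) • y) := by
  obtain ⟨Q, hQ⟩ := h34
  refine exists_sub_two_zsmul_iff_of_sub_eq_two_smul (Q := Q) ?_
  rw [← hQ]; abel

/-- The `ℓ = 0` block of the FIRST sum of Prop. 3.4 is the bare genus period: for `n ≡ 5, 6, 7 (mod 8)` the
decomposition `{n}` qualifies with `d₀ = n` (`MainBlock {n} n`), and its point is `Z(n)` itself (no factor `[i]`, since
`n ≢ 3 (mod 8)`). [cite: TianYuanZhang2017, Prop. 3.4 and its proof (chunk p0011 L76–L89, p0016 L146: "the contribution by d₀ = n, d₁ = 1 is the single term Z(n)")] -/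
theorem prop34SumMain_singleton_term (D : GenusPointData n) (h8 : n % 8 = 5 ∨ n % 8 = 6 ∨ n % 8 = 7) :
    (∑ d₀ ∈ ({n} : Finset ℕ).filter (fun d₀ => MainBlock {n} d₀),
      (∏ d ∈ ({n} : Finset ℕ).erase d₀, gK d) •
        (if d₀ % 8 = 5 ∧ ∃ d ∈ ({n} : Finset ℕ), d % 8 = 3 then D.iPt (D.Z d₀) else D.Z d₀)) = D.Z n := by
  have hM : MainBlock ({n} : Finset ℕ) n := by
    refine ⟨h8, fun d hd hdn => absurd (Finset.mem_singleton.mp hd) hdn, ?_⟩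
    rw [Finset.erase_singleton, Finset.filter_empty, Finset.card_empty]
    exact zero_le_one
  rw [Finset.filter_singleton, if_pos hM, Finset.sum_singleton, Finset.erase_singleton, Finset.prod_empty, one_smul,
    if_neg]
  rintro ⟨h5, d, hd, h3⟩
  rw [Finset.mem_singleton] at hd
  omega

/-- The `ℓ = 0` decomposition `{n}` contributes NOTHING to the SECOND sum of Prop. 3.4 (an `I`-block needs blocks
`≡ 3` and `≡ 2 (mod 8)` besides `d₀`). [cite: TianYuanZhang2017, Prop. 3.4 (chunk p0011 L86–L89)] -/
theorem prop34SumI_singleton_term (D : GenusPointData n) :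
    (∑ d₀ ∈ ({n} : Finset ℕ).filter (fun d₀ => IBlock {n} d₀),
      (∏ d ∈ ({n} : Finset ℕ).erase d₀, gK d) • D.iPt (D.Z d₀)) = 0 := by
  have hI : ¬ IBlock ({n} : Finset ℕ) n := by
    rintro ⟨-, -, h3, -⟩
    rw [Finset.erase_singleton, Finset.filter_empty, Finset.card_empty] at h3
    exact zero_ne_one h3
  rw [Finset.filter_singleton, if_neg hI, Finset.sum_empty]

/-- A finite sum of `ℕ`-multiples with EVEN coefficients is twice a point. [folklore] -/
theorem exists_sum_smul_eq_two_smul {ι : Type*} {G : Type*} [AddCommGroup G] (s : Finset ι) (c : ι → ℕ) (X : ι → G)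
    (hc : ∀ i ∈ s, 2 ∣ c i) : ∃ Q : G, (∑ i ∈ s, c i • X i) = (2 : ℕ) • Q := by
  refine ⟨∑ i ∈ s, (c i / 2) • X i, ?_⟩
  rw [Finset.smul_sum]
  refine Finset.sum_congr rfl fun i hi => ?_
  rw [smul_smul, Nat.mul_div_cancel' (hc i hi)]

/-- **EVEN WEIGHTS: `Σ_main + Σ_I ≡ Z(n) (mod 2A(ℍ′_n))`.** For `1 < n ≡ 5, 6, 7 (mod 8)`: if every qualifying block
`d₀` of every NON-trivial decomposition `S ≠ {n}` of `n` (a `MainBlock` or an `IBlock`) carries an EVEN weight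
`∏_{d ∈ S ∖ {d₀}} g(d)` — as on the `k = 2` sector of the jump-one class, where the only non-trivial weight is `g` of the
prime `≡ 1 (mod 8)` (even by Rédei–Reichardt) — then the two sums of Prop. 3.4 add up to `Z(n)` plus twice a point of
`A(ℍ′_n)`. [cite: TianYuanZhang2017, Prop. 3.4 (chunk p0011 L76–L89)] -/
theorem exists_prop34Sums_eq_Z_add_two_smul (D : GenusPointData n) (hn1 : 1 < n)
    (h8 : n % 8 = 5 ∨ n % 8 = 6 ∨ n % 8 = 7)
    (hw : ∀ S ∈ decompositions n, S ≠ {n} → ∀ d₀ ∈ S, (MainBlock S d₀ ∨ IBlock S d₀) →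
      2 ∣ ∏ d ∈ S.erase d₀, gK d) :
    ∃ Q : APoint D.H, D.prop34SumMain + D.prop34SumI = D.Z n + (2 : ℕ) • Q := by
  have hmem : {n} ∈ decompositions n := singleton_mem_decompositions hn1
  -- the non-trivial decompositions contribute twice a point to each sum
  have hM : ∃ QM : APoint D.H, (∑ S ∈ (decompositions n).erase {n},
      ∑ d₀ ∈ S.filter (fun d₀ => MainBlock S d₀), (∏ d ∈ S.erase d₀, gK d) •
        (if d₀ % 8 = 5 ∧ ∃ d ∈ S, d % 8 = 3 then D.iPt (D.Z d₀) else D.Z d₀)) = (2 : ℕ) • QM := by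
    have hS : ∀ S ∈ (decompositions n).erase {n}, ∃ QS : APoint D.H,
        (∑ d₀ ∈ S.filter (fun d₀ => MainBlock S d₀), (∏ d ∈ S.erase d₀, gK d) •
          (if d₀ % 8 = 5 ∧ ∃ d ∈ S, d % 8 = 3 then D.iPt (D.Z d₀) else D.Z d₀)) = (2 : ℕ) • QS := by
      intro S hS
      obtain ⟨hSne, hSd⟩ := Finset.mem_erase.mp hS
      exact exists_sum_smul_eq_two_smul _ _ _ fun d₀ hd₀ =>
        hw S hSd hSne d₀ (Finset.mem_filter.mp hd₀).1 (Or.inl (Finset.mem_filter.mp hd₀).2)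
    choose QS hQS using hS
    refine ⟨∑ S ∈ ((decompositions n).erase {n}).attach, QS S.1 S.2, ?_⟩
    rw [Finset.smul_sum, ← Finset.sum_attach]
    exact Finset.sum_congr rfl fun S _ => hQS S.1 S.2
  have hI : ∃ QI : APoint D.H, (∑ S ∈ (decompositions n).erase {n},
      ∑ d₀ ∈ S.filter (fun d₀ => IBlock S d₀), (∏ d ∈ S.erase d₀, gK d) • D.iPt (D.Z d₀)) = (2 : ℕ) • QI := by
    have hS : ∀ S ∈ (decompositions n).erase {n}, ∃ QS : APoint D.H,
        (∑ d₀ ∈ S.filter (fun d₀ => IBlock S d₀), (∏ d ∈ S.erase d₀, gK d) • D.iPt (D.Z d₀)) = (2 : ℕ) • QS := by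
      intro S hS
      obtain ⟨hSne, hSd⟩ := Finset.mem_erase.mp hS
      exact exists_sum_smul_eq_two_smul _ _ _ fun d₀ hd₀ =>
        hw S hSd hSne d₀ (Finset.mem_filter.mp hd₀).1 (Or.inr (Finset.mem_filter.mp hd₀).2)
    choose QS hQS using hS
    refine ⟨∑ S ∈ ((decompositions n).erase {n}).attach, QS S.1 S.2, ?_⟩
    rw [Finset.smul_sum, ← Finset.sum_attach]
    exact Finset.sum_congr rfl fun S _ => hQS S.1 S.2
  obtain ⟨QM, hQM⟩ := hM
  obtain ⟨QI, hQI⟩ := hI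
  refine ⟨QM + QI, ?_⟩
  unfold GenusPointData.prop34SumMain GenusPointData.prop34SumI
  rw [← Finset.add_sum_erase _ _ hmem, ← Finset.add_sum_erase _ _ hmem, prop34SumMain_singleton_term D h8,
    prop34SumI_singleton_term D, hQM, hQI, smul_add]
  abel

/-- **C⁺ AT DEPTH ONE, IN GENUS-PERIOD CURRENCY.** Square-free `n ≡ 5, 6, 7 (mod 8)` with `ord_{s=1} L(E_n, s) = 1`; GZK;
data `D` with Thm 3.5's main clause, Prop. 3.4 and integrality displayed; `ρ(n) = 0`; a generator `α` of the free part of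
`A(K_n)⁻` NOT 2-divisible in `A(ℍ′_n)` modulo torsion; all non-trivial Prop-3.4 weights even.  Then the conclusion of
C⁺ at `n` (`2 ∥ L` for every sign choice of `𝓛(n)`) holds **iff the genus period `Z(n)` is NOT 2-divisible in `A(ℍ′_n)`
modulo torsion**.  This is the exact shape in which a depth-one (mod `2A(ℍ′_n)`) genus theorem would discharge C⁺ on the
visible part `{ρ = 0, [α_n] ≠ 0}` of the jump-one class; Lemma 3.21 / Thm 3.6 move `Z(n)` only by `g(n)`-multiples of
torsion points, which vanish in this quotient when `g(n)` is even — so the decision needs an input beyond the displayed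
Galois translates (LEAD census). [cite: TianYuanZhang2017, Thm. 3.5, Prop. 3.4, Lemma 3.21 (chunk p0011 L76–L112, p0020 L27–L45)] [cite: Darmon2004, Thm. 3.22] -/
theorem levelTwo_iff_genusPeriod_not_twoDivisible
    (hGZK : rank_eq_analyticRank_of_analyticRank_le_one) (hsq : Squarefree n)
    (h8 : n % 8 = 5 ∨ n % 8 = 6 ∨ n % 8 = 7) (hr : (congruentNumberCurve n).analyticRank = 1)
    (D : GenusPointData n) (h35 : D.thm35Main) (h34 : D.prop34) (hLs : D.scriptLSpec)
    (hρ0 : (rhoSubgroup n).index = 1) {α : APoint (GenusField n)} (hα : GeneratesFreePart n α)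
    (hα2 : ¬ ∃ y : APoint D.H, IsOfFinAddOrder
      (Point.map (W' := curveA) (D.embK n (Nat.mem_divisors_self n hsq.ne_zero)) α - (2 : ℤ) • y))
    (hw : ∀ S ∈ decompositions n, S ≠ {n} → ∀ d₀ ∈ S, (MainBlock S d₀ ∨ IBlock S d₀) →
      2 ∣ ∏ d ∈ S.erase d₀, gK d) :
    (∀ L : ℤ, IsScriptL n L → (2 : ℤ) ∣ L ∧ ¬ (4 : ℤ) ∣ L) ↔
      ¬ ∃ y : APoint D.H, IsOfFinAddOrder (D.Z n - (2 : ℤ) • y) := by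
  have hn1 : 1 < n := by rcases h8 with h | h | h <;> omega
  obtain ⟨Q, hQ⟩ := exists_prop34Sums_eq_Z_add_two_smul D hn1 h8 hw
  have hZ : (D.prop34SumMain + D.prop34SumI) - D.Z n = (2 : ℕ) • Q := by rw [hQ]; abel
  rw [levelTwo_iff_genusPoint_not_twoDivisible_of_index_eq_one hGZK hsq h8 hr D h35 hLs hρ0 hα hα2,
    genusPoint_twoDivisible_iff_prop34Sums D h34, exists_sub_two_zsmul_iff_of_sub_eq_two_smul hZ]

end PropThreeFour

end Summit.BirchSwinnertonDyer.PrintCf2.LevelTwoModTwo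

end
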